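import Literature.AlgebraicGeometry.Frobenioids.Thm36Sub
import Literature.AlgebraicGeometry.Frobenioids.ModelFrobenioidUnits
import Literature.AlgebraicGeometry.Frobenioids.ModelFrobenioidCofinal
import Literature.AlgebraicGeometry.Frobenioids.ArchimedeanPseudoTerminal
import Literature.AlgebraicGeometry.Frobenioids.ArchimedeanIsometrizationEquivalence
import Literature.AlgebraicGeometry.Frobenioids.ArchimedeanIsotropyPropagation
import Literature.AlgebraicGeometry.Frobenioids.BiratUnits
import Literature.AlgebraicGeometry.Frobenioids.SupportsRealAction
import Literature.AlgebraicGeometry.Frobenioids.PerfectionPrimes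
import Literature.AnabelianGeometry.EtaleTheta.RSupportedMonoids
import HarnessLib

/-!
# Frobenioids II, Theorem 3.6 for `C^ℝ := C^rlf` — lemmas on THE realification of the archimedean Frobenioid:
# the pull-back maps of `Φ^rlf` are identities

Mochizuki, *The geometry of Frobenioids II*, Kyushu J. Math. **62** (2008) 401–460, §3, Example 3.3 (i)–(ii)
p. 28 ("`Φ₀ : D₀ → Mon`, `Spec(K) ↦ ord(K) ≅ ℝ_{≥0}`"; "`C^ℝ := C^rlf` [cf. [Mzk5], Proposition 5.3]") and
Theorem 3.6 pp. 36–38 [cite: MochizukiFrdII2008, Ex 3.3 (ii) p.28].  PROOF-ONLY companion #2 of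
`Thm36Sub.lean` (abc-iut cell, L1 row M13): since the divisor monoid `Φ = Φ₀|_D` of Example 3.3 is the
CONSTANT monoid `ℝ_{≥0}` with identity pull-backs (`ArchFrd.pull_Φ₀`), the realification functor
`Φ^rlf` ([FrdI] Prop. 5.3; `Literature.AnabelianGeometry.EtaleTheta.rlfFunctor`) also has identity
pull-backs (`rlfMap_Φ_eq_id`, by the uniqueness clause of the universal property of `M^rlf`) — the
structural input of the `C^ℝ`-slots of Theorem 3.6 (vi) (pseudo-terminal objects), (i) (ampleness) and (x).
Theorems only; nothing here takes a side on [IUTchIII] Cor. 3.12.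
-/

noncomputable section

namespace Literature.AlgebraicGeometry.Frobenioids

open CategoryTheory Opposite Literature.AnabelianGeometry.EtaleTheta
open scoped NNReal

universe v u

namespace ArchFrd

namespace Thm36Sub

variable {D : Type u} [Category.{v} D] (π : D ⥤ D0)

/-- The pull-back maps of `Φ = Φ₀|_D` are identities (`Φ₀` is the constant monoid `ℝ_{≥0}`, Ex. 3.3 (i)
p. 28), as morphisms of `Mon`. [cite: MochizukiFrdII2008, Ex 3.3 (i) p.28] -/
theorem Φ_map_eq_id {j j' : Dᵒᵖ} (f : j ⟶ j') : (Φ π).map f = 𝟙 _ := rfl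

/-- **The pull-back maps of `Φ^rlf` are identities** for the archimedean Frobenioid: `Φ(f) = id`, so the
unique homomorphism `Φ(j)^rlf → Φ(j')^rlf` over `Φ(f)^pf = id` is the identity ([FrdI] Prop. 5.3, universal
property of the realification). [cite: MochizukiFrdII2008, Ex 3.3 (ii) p.28] -/
theorem rlfMap_Φ_eq_id {j j' : Dᵒᵖ} (f : j ⟶ j') :
    rlfMap (Φ π) (PreFrobenioid.IsPerfFactorialOn.op (isPerfFactorialOn_Φ π)) f = MonoidHom.id _ := by
  apply RlfUniversal.map_id ((PreFrobenioid.IsPerfFactorialOn.op (isPerfFactorialOn_Φ π)) j)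
    ((PreFrobenioid.IsPerfFactorialOn.op (isPerfFactorialOn_Φ π)) j).supports_rlf_R
  exact rlfMap_comp_toRealification (Φ π) _ f

/-- Hence `Φ^rlf(f)(x) = x` on elements. [cite: MochizukiFrdII2008, Ex 3.3 (ii) p.28] -/
theorem rlfFunctor_Φ_map_apply {j j' : Dᵒᵖ} (f : j ⟶ j')
    (x : (rlfFunctor (Φ π) (PreFrobenioid.IsPerfFactorialOn.op (isPerfFactorialOn_Φ π))).obj j) :
    ((rlfFunctor (Φ π) (PreFrobenioid.IsPerfFactorialOn.op (isPerfFactorialOn_Φ π))).map f).hom x = x := by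
  rw [rlfFunctor_map_hom, rlfMap_Φ_eq_id]
  rfl

/-- … and `(Φ^rlf)^gp(f) = id` on the groupifications: `pullGp Φ^rlf f c = c`.
[cite: MochizukiFrdII2008, Ex 3.3 (ii) p.28] -/
theorem pullGp_rlf_eq {X Y : D} (f : X ⟶ Y)
    (c : Algebra.GrothendieckGroup
      ((rlfFunctor (Φ π) (PreFrobenioid.IsPerfFactorialOn.op (isPerfFactorialOn_Φ π))).obj (op Y))) :
    pullGp (rlfFunctor (Φ π) (PreFrobenioid.IsPerfFactorialOn.op (isPerfFactorialOn_Φ π))) f c = c := by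
  have key : pullGp (rlfFunctor (Φ π) (PreFrobenioid.IsPerfFactorialOn.op (isPerfFactorialOn_Φ π))) f =
      MonoidHom.id _ := by
    apply MonGp.hom_ext
    intro a
    rw [pullGp_of]
    exact congrArg Algebra.GrothendieckGroup.of (rlfFunctor_Φ_map_apply π f.op a)
  exact DFunLike.congr_fun key c


/-! ### `ℝ` supports `Φ = ℝ_{≥0}`; `Φ → Φ^rlf` is onto -/

/-- `ℝ` supports `ℝ_{≥0}` ([FrdI] Def. 2.4 (ii)(c): perfect, perf-factorial, every `M_𝔭` `ℝ`-monoprime —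
here `M_𝔭 = M ≅ ℝ_{≥0}`, `M` being archimedean). [cite: MochizukiFrdI2008, Def. 2.4 (ii) p.48] -/
theorem supports_R_nnreal : Supports (Multiplicative ℝ≥0) .R :=
  ⟨isPerfect_multiplicative_nnreal, isPerfFactorial_nnreal, fun 𝔭 =>
    ⟨MonoprimeStructure.nonempty_submonoid_mulEquiv
      (fun _ _ hb => MonoprimeStructure.precsim_of_ne_one isMonoprime_nnreal hb) 𝔭⟩⟩

/-- For `Φ = ℝ_{≥0}` the natural map `Φ(X) → Φ(X)^pf → Φ^rlf(X)` is SURJECTIVE (`ℝ_{≥0}` is perfect, so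
`Φ = Φ^pf`, and `Φ^pf → Φ^rlf` is onto since every `Φ^pf_𝔮 ≅ ℝ_{≥0}` is `ℝ`-monoprime — [FrdI] Def. 2.4
(i)(d)). [cite: MochizukiFrdI2008, Def. 2.4 (i) p.47] -/
theorem toRlf_surjective (X : Dᵒᵖ)
    (b : (rlfFunctor (Φ π) (PreFrobenioid.IsPerfFactorialOn.op (isPerfFactorialOn_Φ π))).obj X) :
    ∃ m : (Φ π).obj X,
      ((PreFrobenioid.IsPerfFactorialOn.op (isPerfFactorialOn_Φ π)) X).toRealification
        (Perfection.of _ m) = b := by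
  have h := (PreFrobenioid.IsPerfFactorialOn.op (isPerfFactorialOn_Φ π)) X
  obtain ⟨c, hc⟩ := IsPerfFactorial.toRealification_surjective_of_isRMonoprime h
    (RSupported.isRMonoprime_pfAt supports_R_nnreal) b
  obtain ⟨m, rfl⟩ := (isPerfect_iff_bijective_of.mp isPerfect_multiplicative_nnreal).2 c
  exact ⟨m, hc⟩

/-! ### `Φ^birat = Φ^gp` for the archimedean Frobenioid: radial endomorphisms have every divisor -/

/-- The object `(Spec K, 𝒪, [tip 1]) ×_{D₀} X` of `C` over `X ∈ Ob(D)` is isotropic ([FrdII] Ex. 3.3 (ii):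
isotropic ⟺ naively isotropic, `Ex33ii_isotropic_iff_holds`). [cite: MochizukiFrdII2008, Ex 3.3 (ii) p.28] -/
theorem isIsotropic_unitObjOver (X : D) : PreFrobenioid.IsIsotropic (C.toElem π) (unitObjOver π X) :=
  (Ex33ii_isotropic_iff_holds π (unitObjOver π X)).mpr (AngularRegion.isIsotropic_isotropicOfTip 1)

/-- The zero divisor of the radial endomorphism `(id, 1, r)` of an object of `C` is `log(1/r)`:
`Div = log(tip / (r · tip))` (Ex. 3.3 (i) p. 28 "`Div(φ) := log(λ)`"). [cite: MochizukiFrdII2008, Ex 3.3 (i) p.28] -/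
theorem div_radialEndC (Y : C π) (r : ArchFrd.PosReal) (hr : r ≤ 1) :
    ((Multiplicative.toAdd (PreFrobenioid.Div (C.toElem π) (radialEndC π Y r hr)) : ℝ≥0) : ℝ) =
      Real.log ((r : ℝ)⁻¹) := by
  change ((Multiplicative.toAdd (C0.div (C0.radialEnd Y.fst r hr)) : ℝ≥0) : ℝ) = _
  rw [C0.coe_toAdd_div]
  unfold C0.ratio
  change Real.log (Y.fst.tip / (‖((ofPosReal ℂ r : ℂˣ) : ℂ)‖ * Y.fst.tip ^ ((1 : ℕ+) : ℕ))) = _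
  rw [C0.norm_coe_ofPosReal, PNat.one_coe, pow_one, mul_comm, ← div_div, div_self Y.fst.tip_pos.ne',
    one_div]

/-- Every element of `Φ(Y_D) = ℝ_{≥0}` is the zero divisor of a radial endomorphism `(id, 1, e^{-t})` of
`Y ∈ Ob(C)`. [cite: MochizukiFrdII2008, Ex 3.3 (i) p.28] -/
theorem exists_radialEndC_div_eq (Y : C π) (t : Multiplicative ℝ≥0) :
    ∃ (r : ArchFrd.PosReal) (hr : r ≤ 1), PreFrobenioid.Div (C.toElem π) (radialEndC π Y r hr) = t := by
  let s : ℝ := ((Multiplicative.toAdd t : ℝ≥0) : ℝ)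
  have hs0 : 0 ≤ s := (Multiplicative.toAdd t).2
  let r : ArchFrd.PosReal := ⟨Real.exp (-s), Real.exp_pos _⟩
  have hr : r ≤ 1 := by
    change Real.exp (-s) ≤ 1
    rw [Real.exp_le_one_iff]
    exact neg_nonpos.mpr hs0
  refine ⟨r, hr, ?_⟩
  have h := div_radialEndC π Y r hr
  have h2 : Real.log ((r : ℝ)⁻¹) = s := by
    change Real.log ((Real.exp (-s))⁻¹) = s
    rw [← Real.exp_neg, neg_neg, Real.log_exp]
  rw [h2] at h
  exact Multiplicative.toAdd.injective (NNReal.eq h)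

/-- **`Φ^birat(X) = Φ(X)^gp`** for the archimedean Frobenioid `C` ([FrdI] Prop. 4.4 (iii); t5's concrete
`biratSubfunctor`): at the isotropic object `Y` of tip `1` over `X`, the pairs `(𝟙_Y, (id, 1, e^{-t}))` are
base-equivalent pre-steps with `𝟙_Y` co-angular, so their divisor differences `-t` — hence all of
`Φ(X)^gp = ℝ` — are birational germs. [cite: MochizukiFrdI2008, Prop. 4.4 (iii) p.83] -/
theorem biratSubfunctor_carrier_eq_top (X : D) :
    (PreFrobenioid.biratSubfunctor (C.toElem π)).carrier X = ⊤ := by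
  -- every `of t`, `t ∈ Φ(X)`, lies in `Φ^birat(X)`
  have hof : ∀ t : (Φ π).obj (op X),
      Algebra.GrothendieckGroup.of t ∈ (PreFrobenioid.biratSubfunctor (C.toElem π)).carrier X := by
    intro t
    obtain ⟨r, hr, ht⟩ := exists_radialEndC_div_eq π (unitObjOver π X) t
    have h₁ : PreFrobenioid.IsCoAngularPreStep (C.toElem π) (𝟙 (unitObjOver π X)) :=
      ⟨C.isCoAngular_of_isIsotropic π _ (isIsotropic_unitObjOver π X),
        PreFrobenioid.isPreStep_id' (C.toElem π) _⟩
    have h₂ : PreFrobenioid.IsPreStep (C.toElem π) (radialEndC π (unitObjOver π X) r hr) := by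
      refine ⟨rfl, ?_⟩
      change IsIso (𝟙 X)
      infer_instance
    have hb : PreFrobenioid.BaseEquivalent (C.toElem π) (𝟙 (unitObjOver π X))
        (radialEndC π (unitObjOver π X) r hr) := by
      unfold PreFrobenioid.BaseEquivalent
      rw [PreFrobenioid.base_id]
      rfl
    have hmem := PreFrobenioid.div_invDiv_mem_biratSubfunctor (F := C.toElem π) _ _ h₁ h₂ hb
    -- `invDiv 𝟙 = 1`, `invDiv δ₂ = Div δ₂ = t`
    have e₁ : PreFrobenioid.invDiv (C.toElem π) (𝟙 (unitObjOver π X)) h₁.2.2 = 1 := by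
      unfold PreFrobenioid.invDiv
      rw [PreFrobenioid.div_id, map_one]
    have e₂ : PreFrobenioid.invDiv (C.toElem π) (radialEndC π (unitObjOver π X) r hr) h₂.2 = t := by
      unfold PreFrobenioid.invDiv
      rw [← ht]
      rfl
    rw [e₁, e₂, map_one, one_div] at hmem
    exact (Subgroup.inv_mem_iff _).mp hmem
  refine eq_top_iff.mpr fun γ _ => ?_
  obtain ⟨a, b, hab⟩ := grothendieckGroup_exists_mul_of_eq_of γ
  have hγ : γ = Algebra.GrothendieckGroup.of a / Algebra.GrothendieckGroup.of b := eq_div_of_mul_eq' hab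
  rw [hγ]
  exact div_mem (hof a) (hof b)

/-! ### `ℝ · Φ^birat = (Φ^rlf)^gp`: the rational-function monoid of `C^rlf` is everything -/

/-- **`(ℝ · Φ^birat)(X) = (Φ^rlf)^gp(X)`** for THE realification of the archimedean Frobenioid: `Φ^rlf(X)` is
the image of `Φ(X) = ℝ_{≥0}` (`toRlf_surjective`) and `Φ^birat(X) = Φ(X)^gp` (`biratSubfunctor_carrier_eq_top`),
so already the `1 • ι(c)` exhaust `(Φ^rlf)^gp(X)` ([FrdI] Prop. 5.3: "`ℝ · Φ^birat ⊆ (Φ^rlf)^gp`").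
[cite: MochizukiFrdI2008, Prop. 5.3 p.103] -/
theorem realSpan_carrier_eq_top (X : D) :
    ((RealificationData.canonical (Φ π)
        (PreFrobenioid.IsPerfFactorialOn.op (isPerfFactorialOn_Φ π))).realSpan
      (PreFrobenioid.biratSubfunctor (C.toElem π))).carrier X = ⊤ := by
  have hof : ∀ b : (rlfFunctor (Φ π) (PreFrobenioid.IsPerfFactorialOn.op (isPerfFactorialOn_Φ π))).obj (op X),
      Algebra.GrothendieckGroup.of b ∈
        ((RealificationData.canonical (Φ π)
            (PreFrobenioid.IsPerfFactorialOn.op (isPerfFactorialOn_Φ π))).realSpan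
          (PreFrobenioid.biratSubfunctor (C.toElem π))).carrier X := by
    intro b
    obtain ⟨m, hm⟩ := toRlf_surjective π (op X) b
    apply Subgroup.subset_closure
    refine ⟨1, Algebra.GrothendieckGroup.of m, ?_, ?_⟩
    · rw [biratSubfunctor_carrier_eq_top]; exact Subgroup.mem_top _
    · rw [RealificationData.rsmul_one]
      change Algebra.GrothendieckGroup.of b =
        MonGp.map (((RealificationData.canonical (Φ π)
          (PreFrobenioid.IsPerfFactorialOn.op (isPerfFactorialOn_Φ π))).toRlf.app (op X)).hom)
          (Algebra.GrothendieckGroup.of m)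
      rw [MonGp.map_of, RealificationData.canonical_toRlf_app_hom, hm]
      rfl
  refine eq_top_iff.mpr fun γ _ => ?_
  obtain ⟨a, b, hab⟩ := grothendieckGroup_exists_mul_of_eq_of γ
  have hγ : γ = Algebra.GrothendieckGroup.of a / Algebra.GrothendieckGroup.of b := eq_div_of_mul_eq' hab
  rw [hγ]
  exact div_mem (hof a) (hof b)

/-! ### Theorem 3.6 (vi) for `C^ℝ = C^rlf` -/

/-- **Thm. 3.6 (vi) for `C^ℝ = C^rlf`** (p. 37): "If `D` admits a pseudo-terminal object, then `F` admits a
pseudo-terminal object" — PROVED for THE realification: over a pseudo-terminal `T ∈ Ob(D)`, the object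
`(T, 0)` of the model Frobenioid is pseudo-terminal, `(A_D, a)` mapping to it by `(1, A_D → T, 0, a)` (the
class `a` IS a "rational function", `realSpan_carrier_eq_top`; pull-backs of `Φ^rlf` are identities). Closes
the slot `Thm36Sub.vi_R` (the `Λ = ℝ` conjunct of the instance `Thm36vi_CA` over THE realification).
[cite: MochizukiFrdII2008, Thm 3.6 (vi) p.37] -/
theorem vi_R_holds : Literature.AlgebraicGeometry.Frobenioids.ArchFrd.Thm36Sub.vi_R π := by
  rintro ⟨T, hT⟩
  refine ⟨⟨T, 1⟩, fun Y => ?_⟩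
  obtain ⟨f⟩ := hT Y.base
  have hmem : Y.cls ∈ ((RealificationData.canonical (Φ π)
        (PreFrobenioid.IsPerfFactorialOn.op (isPerfFactorialOn_Φ π))).realSpan
      (PreFrobenioid.biratSubfunctor (C.toElem π))).carrier Y.base := by
    rw [realSpan_carrier_eq_top]; exact Subgroup.mem_top _
  refine ⟨⟨1, f, 1, ⟨Y.cls, hmem⟩, ?_⟩⟩
  rw [PNat.one_coe, pow_one, map_one, mul_one, map_one, one_mul]
  rfl

end Thm36Sub

end ArchFrd

end Literature.AlgebraicGeometry.Frobenioids

end
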